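import Summits.NavierStokesRegularity.NavierStokesRegularity.Theorems.QuarterJoltLocalEnergyContinuityOfUI
import Summits.NavierStokesRegularity.NavierStokesRegularity.Theorems.QuarterJoltJoltFlatCell
import Summits.NavierStokesRegularity.NavierStokesRegularity.Theses.HodographBetchov

set_option linter.dupNamespace false

/-!
# Route QuarterJolt — crux `NoTerminalJolt` (stmt-NavierStokesRegularity-26463), LEAD line
# `regular_split`: TYPED EDGES OF `NoFastEnergyConcentration` (stmt-18118) — local energy equality at
# every frame time, and WeakLambdaCriterion's `stub_noEnergyAtom` (crux stmt-19625)

Seat ns-ntj-p1 g5 (LEAD of the crux; `--supports 26463 --as helper`), sequel of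
`QuarterJoltLocalEnergyContinuityOfUI.lean` (uniformly integrable energy ⇒ no local `L²` concentration at
the terminal time). By name:

* **`localEnergyContinuity_of_noFastEnergyConcentration`** — shelf statement stmt-18118
  `HodographBetchov.NoFastEnergyConcentration` ⇒ every frame solution (classical on `[0,T)`, Leray–Hopf
  on `[0,T]`, rapidly decaying datum) is LOCALLY strongly `L²`-continuous into its terminal time:
  `∫_{B(x₀,R)} ‖u(t) − u(T)‖² → 0` as `t ↑ T`, for every `x₀`, `R` — the LOCAL form of stub 3 of line
  `regular_split` («energy equality at every frame time»). With the landed converse direction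
  `noFastEnergyConcentration_of_typeIIEnergyEquality` (p642789): stub 3 ⇒ 18118 ⇒ local stub 3; the
  difference is tightness of `|u(t)|²` at spatial infinity as `t ↑ T`.
* `NoTerminalJolt.noEnergyAtomAt_of_tendsto_setLIntegral_ball` — local strong convergence on one ball
  about `x₀` ⇒ no energy atom at `x₀`.
* **`noEnergyAtom_of_noFastEnergyConcentration`** — stmt-18118 ⇒ the statement of WeakLambdaCriterion's
  `stub_noEnergyAtom` (`Cruxes/WeakLambdaCriterion/Lines/birth.lean`, crux stmt-19625) VERBATIM: a NEW
  kernel-checked edge between two shelf records (that stub's docstring: «OPEN beyond Type I»; it is now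
  implied by 18118, and by stub 3 of `regular_split` via p642579).

HONEST FRAMING: conditional implications between OPEN statements; nothing here proves stmt-18118,
stmt-19625, stub 3, `NoTerminalJolt` or Navier–Stokes regularity; no summit statement is proved here.
Lint note: inherits the known `theses-cone` advisory of its imports. [folklore]
-/

noncomputable section

open MeasureTheory Set Function Metric Filter Topology Literature.Analysis.FluidPDE
open scoped ENNReal NNReal

namespace Summit.NavierStokesRegularity.NavierStokesRegularity.Theorems

namespace NoTerminalJolt

/-- **Local strong convergence on one ball ⇒ no energy atom at the centre.** For a Leray–Hopf solution
on `[0,T]` (`T > 0`): if `∫_{B(x₀,R)} ‖u(t) − u(T)‖² → 0` as `t ↑ T` for some `R > 0` (lower-integral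
form), then for every `η > 0` there is `r > 0` with `∫_{B(x₀,r)} ‖u(t)‖² < η` for all `t < T` near `T`
(`∫_{B_r}|u(t)|² ≤ 2∫_{B_R}|u(t) − u(T)|² + 2∫_{B_r}|u(T)|²`, `r ≤ R`, absolute continuity of
`|u(T)|² dx`). [folklore] -/
theorem noEnergyAtomAt_of_tendsto_setLIntegral_ball {ν T : ℝ} (hT : 0 < T)
    {u : ℝ → EuclideanSpace ℝ (Fin 3) → EuclideanSpace ℝ (Fin 3)}
    (hLH : IsLerayHopfOn T ν 0 (u 0) u) (x₀ : EuclideanSpace ℝ (Fin 3)) {R : ℝ} (hR : 0 < R)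
    (hconv : Tendsto (fun t => ∫⁻ z in ball x₀ R, ‖u t z - u T z‖ₑ ^ 2) (𝓝[<] T) (𝓝 0))
    {η : NNReal} (hη : 0 < η) :
    ∃ r : ℝ, 0 < r ∧ ∀ᶠ t in 𝓝[<] T, ∫⁻ x in ball x₀ r, ‖u t x‖ₑ ^ 2 < (η : ℝ≥0∞) := by
  have hmT : MemLp (u T) 2 volume := hLH.memLp T ⟨hT.le, le_rfl⟩
  -- threshold `δ = (η/2)/2`
  set δ : ℝ≥0∞ := (η : ℝ≥0∞) / 2 / 2 with hδ
  have hη' : (η : ℝ≥0∞) ≠ 0 := by exact_mod_cast hη.ne'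
  have hδ0 : 0 < δ := by
    rw [hδ]; exact ENNReal.div_pos (ENNReal.div_pos hη' (by norm_num)).ne' (by norm_num)
  -- (1) a ball of small volume carries little terminal energy (absolute continuity)
  obtain ⟨δT, hδT0, hδT⟩ :=
    exists_pos_setLIntegral_lt_of_measure_lt (lintegral_enorm_sq_ne_top_of_memLp hmT) hδ0.ne'
  have hvol : Tendsto (fun r : ℝ => volume (ball x₀ r)) (𝓝[>] 0) (𝓝 0) := by
    have hball : ∀ r : ℝ, 0 < r → volume (ball x₀ r) =
        ENNReal.ofReal (r ^ 3) * volume (ball (0 : EuclideanSpace ℝ (Fin 3)) 1) := by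
      intro r hr
      rw [Measure.addHaar_ball volume x₀ hr.le, finrank_euclideanSpace_fin]
    have h0 : Tendsto (fun r : ℝ => ENNReal.ofReal (r ^ 3) *
        volume (ball (0 : EuclideanSpace ℝ (Fin 3)) 1)) (𝓝[>] 0) (𝓝 0) := by
      have h1 : Tendsto (fun r : ℝ => r ^ 3) (𝓝[>] (0 : ℝ)) (𝓝 0) := by
        have := ((continuous_pow 3).tendsto (0 : ℝ))
        rw [zero_pow (by norm_num)] at this
        exact tendsto_nhdsWithin_of_tendsto_nhds this
      have h2 : Tendsto (fun r : ℝ => ENNReal.ofReal (r ^ 3)) (𝓝[>] (0 : ℝ)) (𝓝 0) := by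
        rw [← ENNReal.ofReal_zero]; exact ENNReal.tendsto_ofReal h1
      have h3 := ENNReal.Tendsto.mul_const h2
        (Or.inr (measure_ball_lt_top (μ := (volume : Measure (EuclideanSpace ℝ (Fin 3))))
          (x := (0 : EuclideanSpace ℝ (Fin 3))) (r := 1)).ne)
      rwa [zero_mul] at h3
    refine h0.congr' ?_
    filter_upwards [self_mem_nhdsWithin] with r hr
    exact (hball r hr).symm
  obtain ⟨r₁, hr₁, hr₁pos⟩ := ((hvol.eventually (gt_mem_nhds hδT0)).and self_mem_nhdsWithin).exists
  have hr₁T : ∫⁻ x in ball x₀ r₁, ‖u T x‖ₑ ^ 2 < δ := hδT _ hr₁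
  -- the radius: below `r₁` and below `R`
  refine ⟨min r₁ R, lt_min hr₁pos hR, ?_⟩
  have hballs₁ : ball x₀ (min r₁ R) ⊆ ball x₀ r₁ := ball_subset_ball (min_le_left _ _)
  have hballsR : ball x₀ (min r₁ R) ⊆ ball x₀ R := ball_subset_ball (min_le_right _ _)
  -- (2) the local distance on `B(x₀,R)` is eventually `< δ`
  filter_upwards [hconv.eventually (gt_mem_nhds hδ0)] with t ht
  -- (3) combine
  calc ∫⁻ x in ball x₀ (min r₁ R), ‖u t x‖ₑ ^ 2
      ≤ 2 * (∫⁻ x in ball x₀ (min r₁ R), ‖u t x - u T x‖ₑ ^ 2) +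
          2 * ∫⁻ x in ball x₀ (min r₁ R), ‖u T x‖ₑ ^ 2 :=
        JoltFlatCell.setLIntegral_enorm_sq_le hmT.1 _
    _ ≤ 2 * (∫⁻ x in ball x₀ R, ‖u t x - u T x‖ₑ ^ 2) + 2 * ∫⁻ x in ball x₀ r₁, ‖u T x‖ₑ ^ 2 :=
        add_le_add (mul_le_mul' le_rfl (lintegral_mono_set hballsR))
          (mul_le_mul' le_rfl (lintegral_mono_set hballs₁))
    _ < 2 * δ + 2 * δ := by
        have hA : 2 * (∫⁻ x in ball x₀ R, ‖u t x - u T x‖ₑ ^ 2) < 2 * δ := by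
          rw [mul_comm 2 (∫⁻ x in ball x₀ R, ‖u t x - u T x‖ₑ ^ 2), mul_comm 2 δ]
          exact ENNReal.mul_lt_mul_left (by norm_num) (by norm_num) ht
        have hB : 2 * ∫⁻ x in ball x₀ r₁, ‖u T x‖ₑ ^ 2 < 2 * δ := by
          rw [mul_comm 2 (∫⁻ x in ball x₀ r₁, ‖u T x‖ₑ ^ 2), mul_comm 2 δ]
          exact ENNReal.mul_lt_mul_left (by norm_num) (by norm_num) hr₁T
        exact ENNReal.add_lt_add hA hB
    _ = (η : ℝ≥0∞) := by
        rw [hδ, two_mul, ENNReal.add_halves, ENNReal.add_halves]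

end NoTerminalJolt

/-! ### By name: the edges of stmt-18118 -/

/-- **`NoFastEnergyConcentration ⇒ local energy equality at every frame time`** (shelf statement
stmt-18118 BY NAME ⇒ the LOCAL form of stub 3 of line `regular_split`): every classical solution on
`[0,T)` which is Leray–Hopf on `[0,T]` from a rapidly decaying datum is locally strongly `L²`-continuous
into `T` — `∫_{B(x₀,R)} ‖u(t) − u(T)‖² → 0` as `t ↑ T`, for every `x₀` and `R`; in particular a first
blow-up in a world where 18118 holds concentrates no energy on any bounded region. Conditional on the
OPEN statement 18118; nothing is asserted about it. [folklore] -/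
theorem localEnergyContinuity_of_noFastEnergyConcentration
    (h : Theses.HodographBetchov.NoFastEnergyConcentration) :
    ∀ (ν T : ℝ), 0 < ν → 0 < T →
      ∀ (u : ℝ → EuclideanSpace ℝ (Fin 3) → EuclideanSpace ℝ (Fin 3))
        (p : ℝ → EuclideanSpace ℝ (Fin 3) → ℝ),
        Literature.Analysis.FluidPDE.IsClassicalNSSolutionOn (Set.Ico 0 T) ν 0 u p →
        Literature.Analysis.FluidPDE.IsLerayHopfOn T ν 0 (u 0) u →
        Literature.Analysis.FluidPDE.HasRapidSpatialDecay (u 0) →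
        ∀ (x₀ : EuclideanSpace ℝ (Fin 3)) (R : ℝ),
          Filter.Tendsto (fun t => ∫⁻ z in Metric.ball x₀ R, ‖u t z - u T z‖ₑ ^ 2)
            (nhdsWithin T (Set.Iio T)) (nhds 0) := by
  intro ν T hν hT u p hcl hLH hdec x₀ R
  have hUI : ∀ ε : ℝ, 0 < ε → ∃ l : ℝ, 0 < l ∧ ∀ t ∈ Ioo 0 T,
      ∫⁻ x in {x | l < ‖u t x‖}, ‖u t x‖ₑ ^ 2 ≤ ENNReal.ofReal ε := by
    intro ε hε
    obtain ⟨l, hl0, hl⟩ := h ν T hν hT u p hcl hLH hdec ε hε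
    exact ⟨l, hl0, fun t ht => hl t ⟨ht.1.le, ht.2⟩⟩
  exact NoTerminalJolt.tendsto_localEnergy_sub_top_of_uniformIntegrable hν hT hcl hLH hT hUI x₀ R

/-- **`NoFastEnergyConcentration ⇒ no energy atom`** (shelf statement stmt-18118 BY NAME ⇒ the statement
of stub `stub_noEnergyAtom` of `Cruxes/WeakLambdaCriterion/Lines/birth.lean`, crux stmt-19625, route
WeakLambdaEndpoint, VERBATIM): every frame solution is atom-free at every point at its terminal time.
A kernel-checked edge between two shelf records; conditional on the OPEN statement 18118. [folklore] -/
theorem noEnergyAtom_of_noFastEnergyConcentration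
    (h : Theses.HodographBetchov.NoFastEnergyConcentration) :
    ∀ (ν T : ℝ), 0 < ν → 0 < T →
      ∀ (u : ℝ → EuclideanSpace ℝ (Fin 3) → EuclideanSpace ℝ (Fin 3))
        (p : ℝ → EuclideanSpace ℝ (Fin 3) → ℝ),
        Literature.Analysis.FluidPDE.IsClassicalNSSolutionOn (Set.Ico 0 T) ν 0 u p →
        Literature.Analysis.FluidPDE.IsLerayHopfOn T ν 0 (u 0) u →
        Literature.Analysis.FluidPDE.HasRapidSpatialDecay (u 0) →
        ∀ (x₀ : EuclideanSpace ℝ (Fin 3)) (η : NNReal), 0 < η →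
          ∃ r : ℝ, 0 < r ∧ ∀ᶠ t in 𝓝[<] T,
            ∫⁻ x in Metric.ball x₀ r, ‖u t x‖ₑ ^ 2 < (η : ENNReal) := by
  intro ν T hν hT u p hcl hLH hdec x₀ η hη
  exact NoTerminalJolt.noEnergyAtomAt_of_tendsto_setLIntegral_ball hT hLH x₀ one_pos
    (localEnergyContinuity_of_noFastEnergyConcentration h ν T hν hT u p hcl hLH hdec x₀ 1) hη

end Summit.NavierStokesRegularity.NavierStokesRegularity.Theorems

end
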